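import Literature.AlgebraicGeometry.ShimuraVarieties.KudlaRapoport2013.Sec3ComplexUniformizationHolds
import HarnessLib

/-!
# [KudlaRapoport2013, Cor. 3.6, second sentence (arXiv v2 p. 18)] «If `m > n−r`, then `Z(T)(ℂ)` is empty» — DISCHARGED:
# `KR2013_3_6_empty_holds`

Kernel-lane companion of the statement carpet ★
`Literature/AlgebraicGeometry/ShimuraVarieties/KudlaRapoport2013/Sec3ComplexUniformization.lean`: its CLOSED named fact ★
`KR2013_3_6_empty` — S. Kudla, M. Rapoport, *Special cycles on unitary Shimura varieties II: global theory*, J. reine angew.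
Math. 697 (2014) 91–157 = arXiv:0912.3758v2, §3.3 Corollary 3.6 (p. 18): «For `T ∈ Herm_m(O_k)_{>0}`, and `m ≤ n−r`, the
cycle `Z(T)(ℂ)` has codimension `mr`. If `m > n−r`, then `Z(T)(ℂ)` is empty.», typed at the level of
`Inc_∞(T; L, L₀)` (Prop. 3.5: `Z(T)(ℂ) ≃ ∐ [(O_k^× × Γ_L)∖Inc_∞(T; L, L₀)]`) — is PROVED here.  THEOREMS ONLY (no definition,
no named fact, no `sorry`, no instance, no notation); cell hodgecm-mathlib, seat B-typ04 (g31); net debt −1.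

## The proof (as printed: «we note that if `x̃ ∈ (L̃ ⊗ ℝ)^m` with `h̃(x̃, x̃) = T > 0`, then `m ≤ n − r`», p. 18)

The printed argument is the sentence before Cor. 3.6, already discharged in the tree as ★ `KR2013_3_6_pre_holds`
(`Sec3ComplexUniformizationHolds.lean`: for `Jc` of signature `(n−r, r)`, `a > 0` and `x̃₁, …, x̃_m ∈ ℂⁿ` with
`(⟨x̃_i, x̃_j⟩/a)` positive definite, `m ≤ n − r`).  What remains is bookkeeping between the `k`-rational incidence data of
`Inc_∞` and the complex Gram matrix:

* `embedding_krForm` — under a complex embedding `τ` of the CM field `k`, KR's `σ`-hermitian form becomes the complex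
  hermitian pairing: `τ((u, v)_J) = ⟨τu, τv⟩_{J^τ}` (`τ ∘ σ = conj ∘ τ`, the tree's `Liu2021.AppendixC.complexEmbedding_conj`).
* `exists_pos_of_hasSignatureAt_one` — a `1 × 1` Gram matrix `J₀` of signature `(1, 0)` at `τ` has `τ(J₀) = a` real `> 0`
  (`t̄ · τ(J₀) · t = 1` gives `τ(J₀) = |t|⁻²`).
* `KR2013_3_6_empty_holds` — for `(z, x̃) ∈ Inc_∞(T; L, L₀)` condition (1) `h̃(x̃, x̃) = T` gives
  `T^τ = (⟨x̃_i(1), x̃_j(1)⟩_{J^τ} / a)`, positive definite by hypothesis, so ★ `KR2013_3_6_pre_holds` yields `m ≤ n − r`,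
  contradicting `m > n − r`.  (Condition (2) and self-duality are not needed.)

## References
* [KudlaRapoport2013] S. Kudla, M. Rapoport, *Special cycles on unitary Shimura varieties II: global theory*, J. reine angew.
  Math. 697 (2014) 91–157; arXiv:0912.3758v2, §3.3 Prop. 3.5, Cor. 3.6 (p. 18).
-/

set_option autoImplicit false

noncomputable section

open Matrix
open scoped ComplexOrder

namespace Literature.AlgebraicGeometry.ShimuraVarieties.KudlaRapoport2013.Sec3ComplexUniformization

open NumberField
open Literature.NumberTheory.Automorphic.Liu2021.AppendixC (conj complexEmbedding_conj)

section SignatureOne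

variable {k : Type} [Field k]

/-- A `1 × 1` hermitian Gram matrix of signature `(1, 0)` at `τ` has a real positive entry under `τ`:
from `t̄ · τ(J₀) · t = 1` (`T = (t) ∈ GL₁(ℂ)`), `τ(J₀) = |t|⁻² > 0`. [folklore] -/
private theorem exists_pos_of_hasSignatureAt_one (τ : k →+* ℂ) (J₀ : Matrix (Fin 1) (Fin 1) k)
    (h : HasSignatureAt τ J₀ 0) : ∃ a : ℝ, 0 < a ∧ τ (J₀ 0 0) = (a : ℂ) := by
  obtain ⟨T, hT⟩ := h
  have h00 := congrFun (congrFun hT 0) 0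
  simp only [Matrix.mul_apply, Fin.sum_univ_one, Matrix.conjTranspose_apply, Matrix.map_apply, signDiag,
    Matrix.diagonal_apply_eq, Fin.val_zero, Nat.sub_zero, Nat.lt_one_iff, if_true] at h00
  set t : ℂ := (T : Matrix (Fin 1) (Fin 1) ℂ) 0 0 with ht
  have ht0 : t ≠ 0 := by
    rintro h0
    rw [h0, mul_zero] at h00
    exact zero_ne_one h00
  have hn : star t * t = ((Complex.normSq t : ℝ) : ℂ) := by
    rw [Complex.normSq_eq_conj_mul_self, starRingEnd_apply]
  have hpos : 0 < Complex.normSq t := Complex.normSq_pos.mpr ht0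
  refine ⟨(Complex.normSq t)⁻¹, inv_pos.mpr hpos, ?_⟩
  have h1 : τ (J₀ 0 0) * (star t * t) = 1 := by
    calc τ (J₀ 0 0) * (star t * t) = star t * τ (J₀ 0 0) * t := by ring
      _ = 1 := h00
  rw [hn] at h1
  rw [Complex.ofReal_inv]
  exact eq_inv_of_mul_eq_one_left h1

end SignatureOne

section Embedding

variable {k : Type} [Field k] [NumberField k] [IsTotallyComplex k] [Algebra.IsQuadraticExtension ℚ k]

/-- Under a complex embedding `τ` of the CM field `k`, KR's `σ`-hermitian coordinate form `(u, v)_J = σ(v)ᵀ J u` becomes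
the complex hermitian pairing of `J^τ`: `τ((u, v)_J) = ⟨τ ∘ u, τ ∘ v⟩_{J^τ}` (READING R1 of the carpet: `V ⊗_{k,τ} ℂ = ℂⁿ`),
because `τ ∘ σ = conj ∘ τ`. [folklore] -/
private theorem embedding_krForm {n : ℕ} (τ : k →+* ℂ) (J : Matrix (Fin n) (Fin n) k) (u v : Fin n → k) :
    τ (krForm (conj ℚ k : k →+* k) J u v) = krFormC (J.map τ) (τ ∘ u) (τ ∘ v) := by
  unfold krFormC krForm
  rw [RingHom.map_dotProduct]
  have h1 : (τ : k → ℂ) ∘ (((conj ℚ k : k →+* k) : k → k) ∘ v) = (starRingEnd ℂ : ℂ → ℂ) ∘ ((τ : k → ℂ) ∘ v) := by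
    funext p
    simp only [Function.comp_apply]
    exact complexEmbedding_conj ℚ k τ (v p)
  have h2 : (τ : k → ℂ) ∘ (J *ᵥ u) = J.map τ *ᵥ ((τ : k → ℂ) ∘ u) := by
    funext p
    exact RingHom.map_mulVec τ J u p
  rw [h1, h2]

end Embedding

/-- ★ `KR2013_3_6_empty` HOLDS. [KudlaRapoport2013, Cor. 3.6 (arXiv v2 p. 18)]: «If `m > n−r`, then `Z(T)(ℂ)` is empty» —
at the level of Prop. 3.5's incidence sets: for `T ∈ Herm_m(k)` positive definite at `τ`, `m > n − r`, and self-dual hermitian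
lattices `L = (J, L)` of signature `(n−r, r)`, `L₀ = (J₀, L₀)` of signature `(1, 0)`, `Inc_∞(T; L, L₀) = ∅`.  Proof as printed
(«if `x̃ ∈ (L̃ ⊗ ℝ)^m` with `h̃(x̃, x̃) = T > 0`, then `m ≤ n − r`», ★ `KR2013_3_6_pre_holds`), after transporting condition (1)
`h̃(x̃, x̃) = T` along `τ` (`embedding_krForm`, `exists_pos_of_hasSignatureAt_one`).
[cite: KudlaRapoport2013, §3.3 Cor. 3.6 (arXiv v2 p. 18)] -/
theorem KR2013_3_6_empty_holds : KR2013_3_6_empty := by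
  intro k _ _ _ _ τ n r m T hT hm X X₀ hX hX₀
  refine Set.eq_empty_iff_forall_notMem.mpr fun p hp => ?_
  simp only [incInfty, Set.mem_setOf_eq] at hp
  obtain ⟨-, hgram, -⟩ := hp
  obtain ⟨a, ha, hJ₀⟩ := exists_pos_of_hasSignatureAt_one τ X₀.J hX₀.2.1
  set v : Fin m → (Fin n → ℂ) := fun i => (τ : k → ℂ) ∘ colVec (p.2 i) with hv
  have hmat : T.map τ = Matrix.of fun i j => krFormC (X.J.map τ) (v i) (v j) * ((a : ℂ))⁻¹ := by
    ext i j
    rw [← hgram]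
    simp only [Matrix.map_apply, gramTilde, Matrix.of_apply, hTilde, map_mul, map_inv₀, embedding_krForm, hJ₀, hv]
  have hle : m ≤ n - r := KR2013_3_6_pre_holds n r m (X.J.map τ) hX.2.1 a ha v (hmat ▸ hT)
  omega

end Literature.AlgebraicGeometry.ShimuraVarieties.KudlaRapoport2013.Sec3ComplexUniformization
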